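import Mathlib.Data.Matrix.Basis
import Mathlib.Data.Matrix.Mul
import Mathlib.LinearAlgebra.Matrix.StdBasis
import Mathlib.LinearAlgebra.Projection
import Mathlib.LinearAlgebra.Basis.VectorSpace
import Literature.Computability.AlgebraicComplexity.SmallFormatRankSubstitution
import HarnessLib

/-!
# The flag `L_η ⊊ Z_η ⊊ L_{η−1}` of a matrix space and Bläser's separation lemma (Bläser 2003, Lemma 5)

Topic `Literature/Computability/AlgebraicComplexity`. Second proof file behind
`SmallFormatRank.lean` (target `blaser2003_thm14`: `R(⟨n,m,n⟩) ≥ 2mn + 2n − m − 2`,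
Bläser 2003, Thm. 14), building on the abstract substitution method of
`SmallFormatRankSubstitution.lean` (`BilinComp`, `Separates`, Lemma 3, Extension Lemma).

## Content

* `colZero k e h η = L_η^{e,h}`, `zSub k e h η = Z_η^{e,h}`, `rowZero k e h = R^{e,h}` — the
  subspaces of `k^{e×h}` of Bläser 2003, p. 48 (first `η` columns zero; first `η − 1` columns and
  the entry `(1, η)` zero; first row zero). Rows and columns are `0`-indexed (`Fin e`, `Fin h`), so
  "row 1" is the index `0` and "column η" is the index `η − 1`.
* `mulBilin k c m n` — the bilinear map `⟨c,m,n⟩ : (x, y) ↦ xy` on `k^{c×m} × k^{m×n}`; a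
  bilinear computation for `⟨c,m,n⟩` is a `BilinComp (mulBilin k c m n) ι`.
* `exists_proj_of_disjoint` — "a projection onto `B` whose kernel contains `A`" for `A ∩ B = 0`;
  `compChain P σ = P_σ ∘ ⋯ ∘ P_1` and its two properties used in the proof of Lemma 5.
* `blaser2003_lemma5` — **Lemma 5**: for `1 ≤ t ≤ n` and subspaces `W_1, …, W_t ⊆ k^{c×n}` with
  `W_τ ⊆ Z_τ`, `W_τ ∩ L_τ = 0` (`τ < t`), `W_t ⊆ L_t`, `dim W_t ≤ c − 1`, every bilinear
  computation of `⟨c,m,n⟩` separates `(k^{c×m}, L_1^{m,n}, W_1 + ⋯ + W_t)`;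
  `blaser2003_lemma5_card` — with Lemma 3: its length is `≥ cm + m(n−1) + #{i | w_i ∈ W}`.

## The printed proof (p. 49) and this formalisation

Projections `p_τ : L_{τ−1} → L_τ` onto `L_τ` with `W_τ ⊆ ker p_τ` (`τ < t`) and
`π_τ = p_τ ∘ ⋯ ∘ p_1`; then six steps, each an application of the Extension Lemma refuted by an
explicit matrix unit: (1) `(0,0,W)`; (2) `(0, L_t, W)` — else `k^{c×m} b ⊆ W_t` for some
`b ≠ 0`, contradicting `dim W_t < c`; (3) `(R, L_t, W)` — else `π_{t−1}(a k^{m×n}) ⊆ L_t` although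
`a E_{μt}` has a non-zero `t`-th column; (4)–(5) `(R, L_τ, W) ⇒ (R, L_{τ−1}, W)` — else
`k^{c×m} b ⊆ R b + W_τ + ⋯ + W_t ⊆ Z_τ` although `E_{1μ} b` has entry `(1,τ) ≠ 0`;
(6) `(k^{c×m}, L_1, W)` — else `a k^{m×n} ⊆ L_1 + W ⊆ Z_1` although `(a E_{μ1})_{11} ≠ 0`.
We take the `p_τ` as endomorphisms of all of `k^{c×n}` (identity on `L_τ`, zero on `W_τ`), which
changes nothing, and only ever use the inclusions `π_τ(W) ⊆ W_{τ+1} + ⋯ + W_t`.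

## References

* M. Bläser, *On the complexity of the multiplication of matrices of small formats*,
  J. Complexity 19 (2003) 43–60: §4 p. 48 (the subspaces), Lemma 5 and its proof (pp. 48–49).
  [Blaser2003]
-/

namespace Literature.Computability.AlgebraicComplexity

open Module

variable {k : Type*} [Field k]

/-! ## The subspaces `L_η`, `Z_η`, `R` of a matrix space (Bläser 2003, §4, p. 48) -/

section Subspaces

variable (k)

/-- `L_η^{e,h} ⊆ k^{e×h}`: the matrices whose first `η` columns vanish (Bläser 2003, p. 48;
`L_0` is everything, `L_h` is zero). Columns are indexed from `0` here, so the condition is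
`x i j = 0` for `j < η`. [cite: Blaser2003, §4 p. 48] -/
def colZero (e h η : ℕ) : Submodule k (Matrix (Fin e) (Fin h) k) where
  carrier := {x | ∀ (i : Fin e) (j : Fin h), (j : ℕ) < η → x i j = 0}
  add_mem' ha hb i j hj := by simp [ha i j hj, hb i j hj]
  zero_mem' _ _ _ := rfl
  smul_mem' c x hx i j hj := by simp [hx i j hj]

/-- `Z_η^{e,h} ⊆ k^{e×h}` (`1 ≤ η ≤ h`): the matrices whose first `η − 1` columns vanish and whose
entry in position `(1, η)` vanishes (Bläser 2003, p. 48: `L_η ⊊ Z_η ⊊ L_{η−1}`). With `0`-indexed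
rows and columns: `x i j = 0` for `j + 1 < η`, and `x 0 (η−1) = 0`. [cite: Blaser2003, §4 p. 48] -/
def zSub (e h η : ℕ) : Submodule k (Matrix (Fin e) (Fin h) k) where
  carrier := {x | (∀ (i : Fin e) (j : Fin h), (j : ℕ) + 1 < η → x i j = 0) ∧
    ∀ (i : Fin e) (j : Fin h), (i : ℕ) = 0 → (j : ℕ) + 1 = η → x i j = 0}
  add_mem' ha hb := ⟨fun i j hj => by simp [ha.1 i j hj, hb.1 i j hj],
    fun i j hi hj => by simp [ha.2 i j hi hj, hb.2 i j hi hj]⟩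
  zero_mem' := ⟨fun _ _ _ => rfl, fun _ _ _ _ => rfl⟩
  smul_mem' c x hx := ⟨fun i j hj => by simp [hx.1 i j hj], fun i j hi hj => by simp [hx.2 i j hi hj]⟩

/-- `R^{e,h} ⊆ k^{e×h}`: the matrices whose first row vanishes (Bläser 2003, p. 48).
[cite: Blaser2003, §4 p. 48] -/
def rowZero (e h : ℕ) : Submodule k (Matrix (Fin e) (Fin h) k) where
  carrier := {x | ∀ (i : Fin e) (j : Fin h), (i : ℕ) = 0 → x i j = 0}
  add_mem' ha hb i j hi := by simp [ha i j hi, hb i j hi]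
  zero_mem' _ _ _ := rfl
  smul_mem' c x hx i j hi := by simp [hx i j hi]

variable {k}

/-- Membership in `L_η`. [cite: Blaser2003, §4 p. 48] -/
@[simp] theorem mem_colZero {e h η : ℕ} {x : Matrix (Fin e) (Fin h) k} :
    x ∈ colZero k e h η ↔ ∀ (i : Fin e) (j : Fin h), (j : ℕ) < η → x i j = 0 := Iff.rfl

/-- Membership in `Z_η`. [cite: Blaser2003, §4 p. 48] -/
@[simp] theorem mem_zSub {e h η : ℕ} {x : Matrix (Fin e) (Fin h) k} :
    x ∈ zSub k e h η ↔ (∀ (i : Fin e) (j : Fin h), (j : ℕ) + 1 < η → x i j = 0) ∧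
      ∀ (i : Fin e) (j : Fin h), (i : ℕ) = 0 → (j : ℕ) + 1 = η → x i j = 0 := Iff.rfl

/-- Membership in `R`. [cite: Blaser2003, §4 p. 48] -/
@[simp] theorem mem_rowZero {e h : ℕ} {x : Matrix (Fin e) (Fin h) k} :
    x ∈ rowZero k e h ↔ ∀ (i : Fin e) (j : Fin h), (i : ℕ) = 0 → x i j = 0 := Iff.rfl

/-- `L_0` is the whole space. [cite: Blaser2003, §4 p. 48] -/
theorem colZero_zero (e h : ℕ) : colZero k e h 0 = ⊤ := by
  ext x; simp

/-- The `L_η` decrease. [cite: Blaser2003, §4 p. 48] -/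
theorem colZero_antitone (e h : ℕ) {η η' : ℕ} (hle : η ≤ η') : colZero k e h η' ≤ colZero k e h η :=
  fun _ hx i j hj => hx i j (lt_of_lt_of_le hj hle)

/-- `L_η ⊆ Z_η`. [cite: Blaser2003, §4 p. 48] -/
theorem colZero_le_zSub (e h η : ℕ) : colZero k e h η ≤ zSub k e h η :=
  fun _ hx => ⟨fun i j hj => hx i j (by omega), fun i j _ hj => hx i j (by omega)⟩

/-- `Z_η ⊆ L_{η−1}`. [cite: Blaser2003, §4 p. 48] -/
theorem zSub_le_colZero (e h η : ℕ) : zSub k e h η ≤ colZero k e h (η - 1) :=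
  fun _ hx i j hj => hx.1 i j (by omega)

end Subspaces

/-! ## Matrix multiplication as a bilinear map; computations for `⟨c, m, n⟩` -/

section MatMul

variable (k)

/-- The bilinear map `⟨c, m, n⟩ : k^{c×m} × k^{m×n} → k^{c×n}`, `(x, y) ↦ xy` (Bläser 2003, §1.1).
[cite: Blaser2003, §1.1] -/
def mulBilin (c m n : ℕ) :
    Matrix (Fin c) (Fin m) k →ₗ[k] Matrix (Fin m) (Fin n) k →ₗ[k] Matrix (Fin c) (Fin n) k :=
  LinearMap.mk₂ k (· * ·) Matrix.add_mul (fun a x y => Matrix.smul_mul a x y) Matrix.mul_add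
    fun a x y => Matrix.mul_smul x a y

variable {k}

/-- `⟨c,m,n⟩(x, y) = xy`. [cite: Blaser2003, §1.1] -/
@[simp] theorem mulBilin_apply (c m n : ℕ) (x : Matrix (Fin c) (Fin m) k)
    (y : Matrix (Fin m) (Fin n) k) : mulBilin k c m n x y = x * y := rfl

/-- `x b ∈ L_η^{c,n}` when `b ∈ L_η^{m,n}`. [cite: Blaser2003, Lemma 5 (proof)] -/
theorem mul_mem_colZero {c m n η : ℕ} (x : Matrix (Fin c) (Fin m) k) {b : Matrix (Fin m) (Fin n) k}
    (hb : b ∈ colZero k m n η) : x * b ∈ colZero k c n η := by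
  intro i j hj
  rw [Matrix.mul_apply]
  exact Finset.sum_eq_zero fun μ _ => by rw [hb μ j hj, mul_zero]

/-- Entries of `E_{λμ} b`: row `λ` is row `μ` of `b`, the other rows vanish. [folklore] -/
theorem single_mul_apply' {c m n : ℕ} (l : Fin c) (μ : Fin m) (b : Matrix (Fin m) (Fin n) k)
    (i : Fin c) (j : Fin n) :
    (Matrix.single l μ (1 : k) * b) i j = if i = l then b μ j else 0 := by
  split_ifs with h
  · subst h; simp
  · simp [h]

/-- Entries of `a E_{μν}`: column `ν` is column `μ` of `a`, the other columns vanish. [folklore] -/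
theorem mul_single_apply' {c m n : ℕ} (a : Matrix (Fin c) (Fin m) k) (μ : Fin m) (ν : Fin n)
    (i : Fin c) (j : Fin n) :
    (a * Matrix.single μ ν (1 : k)) i j = if j = ν then a i μ else 0 := by
  split_ifs with h
  · subst h; simp
  · simp [h]

end MatMul

/-! ## Projections and their chains (Bläser 2003, proof of Lemma 5) -/

section Projections

variable {E : Type*} [AddCommGroup E] [Module k E]

/-- For subspaces `A, B` with `A ∩ B = 0` there is a projection onto `B` whose kernel contains `A`
(used throughout Bläser 2003, §§4–5: "choose a projection `p` onto `L` such that `W ⊆ ker p`").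
[cite: Blaser2003, Lemma 5 (proof)] -/
theorem exists_proj_of_disjoint (A B : Submodule k E) (hAB : Disjoint A B) :
    ∃ P : E →ₗ[k] E, (∀ x ∈ B, P x = x) ∧ (∀ x ∈ A, P x = 0) ∧ ∀ x, P x ∈ B := by
  obtain ⟨C, hC⟩ := (A ⊔ B).exists_isCompl
  have hBq : IsCompl B (A ⊔ C) := by
    refine ⟨Submodule.disjoint_def.2 fun x hxB hxq => ?_, ?_⟩
    · obtain ⟨a, ha, c', hc', rfl⟩ := Submodule.mem_sup.1 hxq
      have hcAB : c' ∈ A ⊔ B := by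
        have : a + c' - a ∈ A ⊔ B := Submodule.sub_mem _ (Submodule.mem_sup_right hxB)
          (Submodule.mem_sup_left ha)
        simpa using this
      have hc0 : c' = 0 := Submodule.disjoint_def.1 hC.disjoint c' hcAB hc'
      subst hc0
      have haB : a ∈ B := by simpa using hxB
      have ha0 : a = 0 := Submodule.disjoint_def.1 hAB a ha haB
      simp [ha0]
    · rw [codisjoint_iff, ← sup_assoc, sup_comm B A]
      exact hC.codisjoint.eq_top
  refine ⟨B.projection (A ⊔ C) hBq, fun x hx => Submodule.projection_apply_of_mem_left hBq hx,
    fun x hx => Submodule.projection_apply_of_mem_right hBq (Submodule.mem_sup_left hx),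
    fun x => Submodule.projection_apply_mem hBq x⟩

/-- The chain `π_σ = P_σ ∘ ⋯ ∘ P_1` (`π_0 = id`) of a sequence of endomorphisms
(Bläser 2003, proof of Lemma 5). [cite: Blaser2003, Lemma 5 (proof)] -/
def compChain (P : ℕ → E →ₗ[k] E) : ℕ → E →ₗ[k] E
  | 0 => LinearMap.id
  | σ + 1 => (P (σ + 1)).comp (compChain P σ)

/-- `π_0 = id`. [cite: Blaser2003, Lemma 5 (proof)] -/
@[simp] theorem compChain_zero (P : ℕ → E →ₗ[k] E) (x : E) : compChain P 0 x = x := rfl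

/-- `π_{σ+1} = P_{σ+1} ∘ π_σ`. [cite: Blaser2003, Lemma 5 (proof)] -/
@[simp] theorem compChain_succ (P : ℕ → E →ₗ[k] E) (σ : ℕ) (x : E) :
    compChain P (σ + 1) x = P (σ + 1) (compChain P σ x) := rfl

/-- If each `P_τ` fixes `L_τ` pointwise and the `L_τ` decrease, then `π_σ` is the identity on
`L_σ` (Bläser 2003, proof of Lemma 5). [cite: Blaser2003, Lemma 5 (proof)] -/
theorem compChain_apply_of_mem (P : ℕ → E →ₗ[k] E) (L : ℕ → Submodule k E)
    (hL : ∀ σ, L (σ + 1) ≤ L σ) (hfix : ∀ τ, ∀ x ∈ L τ, P τ x = x) :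
    ∀ σ, ∀ x ∈ L σ, compChain P σ x = x := by
  intro σ
  induction σ with
  | zero => intro x _; rfl
  | succ σ ih =>
    intro x hx
    rw [compChain_succ, ih x (hL σ hx), hfix (σ + 1) x hx]

/-- If moreover `P_τ` kills `x ∈ L_{τ−1}` (`τ ≥ 1`), then `π_σ x = 0` for all `σ ≥ τ`
(Bläser 2003, proof of Lemma 5: `π_τ(W) = W_{τ+1} + ⋯ + W_t`). [cite: Blaser2003, Lemma 5 (proof)] -/
theorem compChain_apply_eq_zero (P : ℕ → E →ₗ[k] E) (L : ℕ → Submodule k E)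
    (hL : ∀ σ, L (σ + 1) ≤ L σ) (hfix : ∀ τ, ∀ x ∈ L τ, P τ x = x) {τ : ℕ} (hτ : 1 ≤ τ) {x : E}
    (hx : x ∈ L (τ - 1)) (hkill : P τ x = 0) : ∀ σ, τ ≤ σ → compChain P σ x = 0 := by
  have hτx : compChain P τ x = 0 := by
    obtain ⟨τ', rfl⟩ : ∃ τ', τ = τ' + 1 := ⟨τ - 1, by omega⟩
    rw [compChain_succ, compChain_apply_of_mem P L hL hfix τ' x (by simpa using hx), hkill]
  intro σ hσ
  obtain ⟨d, rfl⟩ := Nat.exists_eq_add_of_le hσ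
  induction d with
  | zero => simpa using hτx
  | succ d ih =>
    rw [← Nat.add_assoc, compChain_succ, ih (by omega), map_zero]

/-- Induction principle for membership in `⨆ τ ∈ s, p τ`. [folklore] -/
theorem biSup_induction {s : Finset ℕ} (p : ℕ → Submodule k E) {motive : E → Prop} {x : E}
    (hx : x ∈ ⨆ τ ∈ s, p τ) (mem : ∀ τ ∈ s, ∀ y ∈ p τ, motive y) (zero : motive 0)
    (add : ∀ y z, motive y → motive z → motive (y + z)) : motive x := by
  refine Submodule.iSup_induction (motive := motive) (fun τ => ⨆ (_ : τ ∈ s), p τ) hx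
    (fun τ y hy => ?_) zero add
  by_cases hτ : τ ∈ s
  · rw [iSup_pos hτ] at hy
    exact mem τ hτ y hy
  · rw [iSup_neg hτ, Submodule.mem_bot] at hy
    exact hy ▸ zero

end Projections

/-! ## Lemma 5 -/

section Lemma5

variable {c m n : ℕ} {ι : Type*} [Fintype ι]

/-- **Bläser 2003, Lemma 5.** Let `1 ≤ t ≤ n` and let `W_1, …, W_t ⊆ k^{c×n}` be subspaces with
`W_τ ⊆ Z_τ^{c,n}` and `W_τ ∩ L_τ^{c,n} = 0` for `1 ≤ τ ≤ t − 1`, `W_t ⊆ L_t^{c,n}` and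
`dim W_t ≤ c − 1`. Then every bilinear computation of `⟨c, m, n⟩` separates
`(k^{c×m}, L_1^{m,n}, W_1 + ⋯ + W_t)`. (Proof as printed, pp. 49: projections `p_τ` onto `L_τ`
along `W_τ`, `π_τ = p_τ ∘ ⋯ ∘ p_1`, and six applications of the Extension Lemma.)
[cite: Blaser2003, Lemma 5] -/
theorem blaser2003_lemma5 (β : BilinComp (mulBilin k c m n) ι) (hc : 0 < c) {t : ℕ}
    (ht1 : 1 ≤ t) (htn : t ≤ n) (Wf : ℕ → Submodule k (Matrix (Fin c) (Fin n) k))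
    (hZ : ∀ τ, 1 ≤ τ → τ < t → Wf τ ≤ zSub k c n τ)
    (hdisj : ∀ τ, 1 ≤ τ → τ < t → Disjoint (Wf τ) (colZero k c n τ))
    (hLt : Wf t ≤ colZero k c n t) (hdim : finrank k (Wf t) < c) :
    β.Separates ⊤ (colZero k m n 1) (⨆ τ ∈ Finset.Icc 1 t, Wf τ) := by
  classical
  set L : ℕ → Submodule k (Matrix (Fin c) (Fin n) k) := fun η => colZero k c n η with hLdef
  set Wsum : Submodule k (Matrix (Fin c) (Fin n) k) := ⨆ τ ∈ Finset.Icc 1 t, Wf τ with hWsum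
  have hLanti : ∀ σ, L (σ + 1) ≤ L σ := fun σ => colZero_antitone c n (Nat.le_succ σ)
  -- every `W_τ` lies in `L_{τ-1}`
  have hWL : ∀ τ, 1 ≤ τ → τ ≤ t → Wf τ ≤ L (τ - 1) := by
    intro τ h1 h2
    rcases lt_or_eq_of_le h2 with hlt | rfl
    · exact (hZ τ h1 hlt).trans (zSub_le_colZero c n τ)
    · exact hLt.trans (colZero_antitone c n (Nat.sub_le τ 1))
  -- the projections `P_τ` (identity outside `1 ≤ τ < t`)
  have hP : ∀ τ, ∃ P : Matrix (Fin c) (Fin n) k →ₗ[k] Matrix (Fin c) (Fin n) k,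
      (∀ x ∈ L τ, P x = x) ∧ (1 ≤ τ → τ < t → ∀ x ∈ Wf τ, P x = 0) := by
    intro τ
    by_cases hτ : 1 ≤ τ ∧ τ < t
    · obtain ⟨P, hPB, hPA, -⟩ := exists_proj_of_disjoint (Wf τ) (L τ) (hdisj τ hτ.1 hτ.2)
      exact ⟨P, hPB, fun _ _ => hPA⟩
    · exact ⟨LinearMap.id, fun x _ => rfl, fun h1 h2 => absurd ⟨h1, h2⟩ hτ⟩
  choose P hPfix hPkill using hP
  -- `π_σ` is the identity on `L_σ`
  have hπfix : ∀ σ, ∀ x ∈ L σ, compChain P σ x = x := compChain_apply_of_mem P L hLanti hPfix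
  -- `π_σ` kills `W_τ` for `τ ≤ σ`, `τ < t`
  have hπkill : ∀ τ, 1 ≤ τ → τ < t → ∀ x ∈ Wf τ, ∀ σ, τ ≤ σ → compChain P σ x = 0 :=
    fun τ h1 h2 x hx => compChain_apply_eq_zero P L hLanti hPfix h1 (hWL τ h1 h2.le hx)
      (hPkill τ h1 h2 x hx)
  -- (b1): `π_{t-1}(W) ⊆ W_t`
  have hb1 : ∀ x ∈ Wsum, compChain P (t - 1) x ∈ Wf t := by
    intro x hx
    refine biSup_induction Wf (motive := fun y => compChain P (t - 1) y ∈ Wf t) hx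
      (fun τ hτ y hy => ?_) (by simp) (fun y z hy hz => by simpa [map_add] using add_mem hy hz)
    obtain ⟨h1, h2⟩ := Finset.mem_Icc.1 hτ
    rcases lt_or_eq_of_le h2 with hlt | rfl
    · rw [hπkill τ h1 hlt y hy (t - 1) (by omega)]
      exact Submodule.zero_mem _
    · rwa [hπfix (τ - 1) y (hWL τ h1 le_rfl hy)]
  -- (b2): for `1 ≤ σ < t`, the entry `(0, σ)` of `π_σ(x)` vanishes for `x ∈ W`
  have hb2 : ∀ σ, σ < t → ∀ x ∈ Wsum, ∀ (i : Fin c) (j : Fin n), (i : ℕ) = 0 → (j : ℕ) = σ →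
      compChain P σ x i j = 0 := by
    intro σ hσt x hx i j hi hj
    refine biSup_induction Wf (motive := fun y => compChain P σ y i j = 0) hx
      (fun τ hτ y hy => ?_) (by simp) (fun y z hy hz => by rw [map_add, Matrix.add_apply, hy, hz, add_zero])
    obtain ⟨h1, h2⟩ := Finset.mem_Icc.1 hτ
    by_cases hτσ : τ ≤ σ
    · rw [hπkill τ h1 (by omega) y hy σ hτσ]; rfl
    · rw [hπfix σ y (hWL τ h1 h2 hy |> fun h => colZero_antitone c n (by omega) h)]
      -- `y ∈ W_τ` with `τ > σ`
      rcases lt_or_eq_of_le h2 with hlt | rfl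
      · by_cases hτσ1 : τ = σ + 1
        · exact (hZ τ h1 hlt hy).2 i j hi (by omega)
        · exact (hZ τ h1 hlt hy).1 i j (by omega)
      · exact hLt hy i j (by omega)
  -- W ⊆ Z_1: the entry `(0,0)` vanishes on `W`
  have hW00 : ∀ x ∈ Wsum, ∀ (i : Fin c) (j : Fin n), (i : ℕ) = 0 → (j : ℕ) = 0 → x i j = 0 := by
    intro x hx i j hi hj
    refine biSup_induction Wf (motive := fun y => y i j = 0) hx
      (fun τ hτ y hy => ?_) rfl (fun y z hy hz => by rw [Matrix.add_apply, hy, hz, add_zero])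
    obtain ⟨h1, h2⟩ := Finset.mem_Icc.1 hτ
    rcases lt_or_eq_of_le h2 with hlt | rfl
    · by_cases hτ1 : τ = 1
      · subst hτ1; exact (hZ 1 le_rfl hlt hy).2 i j hi (by omega)
      · exact (hZ τ h1 hlt hy).1 i j (by omega)
    · exact hLt hy i j (by omega)
  have hc0 : (0 : ℕ) < c := hc
  set i0 : Fin c := ⟨0, hc0⟩ with hi0
  -- Step 2: β separates (0, L_t^{m,n}, W)
  have step2 : β.Separates ⊥ (colZero k m n t) Wsum := by
    rcases (β.separates_bot_bot Wsum).extension_right (V₂ := colZero k m n t) with h | h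
    · exact h
    · exfalso
      obtain ⟨b, hbL, hb0, hb⟩ := h
      have hb0' : b ≠ 0 := fun h0 => hb0 (by simp [h0])
      obtain ⟨μ, ν, hμν⟩ : ∃ μ ν, b μ ν ≠ 0 := by
        by_contra hall
        push Not at hall
        exact hb0' (Matrix.ext fun μ ν => hall μ ν)
      -- every `x b` lies in `W_t`
      have hxb : ∀ x : Matrix (Fin c) (Fin m) k, x * b ∈ Wf t := by
        intro x
        obtain ⟨u₁, hu₁, hmem⟩ := hb x
        rw [Submodule.mem_bot] at hu₁
        subst hu₁
        simp only [map_zero, LinearMap.zero_apply, sub_zero, mulBilin_apply] at hmem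
        have hfix : compChain P (t - 1) (x * b) = x * b :=
          hπfix (t - 1) (x * b) (colZero_antitone c n (Nat.sub_le t 1) (mul_mem_colZero x hbL))
        rw [← hfix]
        exact hb1 _ hmem
      -- the `c` matrices `E_{λμ} b` are linearly independent elements of `W_t`
      have hli : LinearIndependent k fun l : Fin c => Matrix.single l μ (1 : k) * b := by
        rw [Fintype.linearIndependent_iff]
        intro g hg l
        have h := congrFun (congrFun hg l) ν
        rw [Matrix.sum_apply, Matrix.zero_apply] at h
        simp only [Matrix.smul_apply, smul_eq_mul, single_mul_apply'] at h
        rw [Finset.sum_eq_single l (fun l' _ hl' => by rw [if_neg (Ne.symm hl'), mul_zero])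
          (fun hl => absurd (Finset.mem_univ l) hl), if_pos rfl] at h
        exact (mul_eq_zero.1 h).resolve_right hμν
      have hli' : LinearIndependent k fun l : Fin c =>
          (⟨Matrix.single l μ (1 : k) * b, hxb _⟩ : Wf t) :=
        LinearIndependent.of_comp (Wf t).subtype hli
      have := hli'.fintype_card_le_finrank
      rw [Fintype.card_fin] at this
      omega
  -- Step 3: β separates (R^{c,m}, L_t^{m,n}, W)
  have step3 : β.Separates (rowZero k c m) (colZero k m n t) Wsum := by
    rcases step2.extension_left (U₂ := rowZero k c m) with h | h
    · exact h
    · exfalso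
      obtain ⟨a, -, ha0, ha⟩ := h
      have ha0' : a ≠ 0 := fun h0 => ha0 (by simp [h0])
      obtain ⟨l, μ, hlμ⟩ : ∃ l μ, a l μ ≠ 0 := by
        by_contra hall
        push Not at hall
        exact ha0' (Matrix.ext fun l μ => hall l μ)
      have htn' : t - 1 < n := by omega
      set jt : Fin n := ⟨t - 1, htn'⟩ with hjt
      obtain ⟨y₁, hy₁, hmem⟩ := ha (Matrix.single μ jt (1 : k))
      simp only [mulBilin_apply] at hmem
      -- apply `π_{t-1}`
      have h1 : compChain P (t - 1) (a * Matrix.single μ jt (1 : k) - a * y₁) ∈ Wf t := hb1 _ hmem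
      have hay₁ : a * y₁ ∈ L t := mul_mem_colZero a hy₁
      have hay : a * Matrix.single μ jt (1 : k) ∈ L (t - 1) := by
        intro i j hj
        rw [mul_single_apply', if_neg]
        exact fun h => by simp [h, hjt] at hj
      have hay₁' : a * y₁ ∈ L (t - 1) := colZero_antitone c n (Nat.sub_le t 1) hay₁
      rw [map_sub, hπfix _ _ hay, hπfix _ _ hay₁'] at h1
      have h2 : (a * Matrix.single μ jt (1 : k) - a * y₁) l jt = 0 := hLt h1 l jt (by simp [hjt]; omega)
      have h3 : (a * y₁) l jt = 0 := hay₁ l jt (by simp [hjt]; omega)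
      rw [Matrix.sub_apply, h3, sub_zero, mul_single_apply', if_pos rfl] at h2
      exact hlμ h2
  -- Step 4/5: descending induction down to (R^{c,m}, L_1^{m,n}, W)
  have step5 : ∀ d, d ≤ t - 1 → β.Separates (rowZero k c m) (colZero k m n (t - d)) Wsum := by
    intro d
    induction d with
    | zero => intro _; exact step3
    | succ d ih =>
      intro hd
      have ih' := ih (by omega)
      set σ := t - (d + 1) with hσ
      have hσ1 : 1 ≤ σ := by omega
      have hσt : σ < t := by omega
      have htd : t - d = σ + 1 := by omega
      rw [htd] at ih'
      rcases ih'.extension_right (V₂ := colZero k m n σ) with h | h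
      · exact h
      · exfalso
        obtain ⟨b, hbσ, hbσ1, hb⟩ := h
        -- `b` has a nonzero entry in column `σ`
        have hσn : σ < n := by omega
        set jσ : Fin n := ⟨σ, hσn⟩ with hjσ
        obtain ⟨μ, hμ⟩ : ∃ μ, b μ jσ ≠ 0 := by
          by_contra hall
          push Not at hall
          refine hbσ1 fun i j hj => ?_
          rcases lt_or_eq_of_le (Nat.lt_succ_iff.1 hj) with hlt | heq
          · exact hbσ i j hlt
          · have : j = jσ := Fin.ext (by simp [hjσ, heq])
            rw [this]; exact hall i
        obtain ⟨x₁, hx₁, hmem⟩ := hb (Matrix.single i0 μ (1 : k))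
        simp only [mulBilin_apply] at hmem
        have hxb : Matrix.single i0 μ (1 : k) * b ∈ L σ := mul_mem_colZero _ hbσ
        have hx₁b : x₁ * b ∈ L σ := mul_mem_colZero _ hbσ
        have h1 := hb2 σ hσt _ hmem i0 jσ rfl rfl
        rw [map_sub, hπfix σ _ hxb, hπfix σ _ hx₁b, Matrix.sub_apply] at h1
        have h2 : (x₁ * b) i0 jσ = 0 := by
          rw [Matrix.mul_apply]
          exact Finset.sum_eq_zero fun μ' _ => by rw [hx₁ i0 μ' rfl, zero_mul]
        rw [h2, sub_zero, single_mul_apply', if_pos rfl] at h1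
        exact hμ h1
  have step5' : β.Separates (rowZero k c m) (colZero k m n 1) Wsum := by
    have := step5 (t - 1) le_rfl
    rwa [show t - (t - 1) = 1 by omega] at this
  -- Step 6: β separates (k^{c×m}, L_1^{m,n}, W)
  rcases step5'.extension_left (U₂ := ⊤) with h | h
  · exact h
  · exfalso
    obtain ⟨a, -, haR, ha⟩ := h
    obtain ⟨μ, hμ⟩ : ∃ μ, a i0 μ ≠ 0 := by
      by_contra hall
      push Not at hall
      exact haR fun i j hi => by
        have : i = i0 := Fin.ext hi
        rw [this]; exact hall j
    have hn0 : 0 < n := by omega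
    set j0 : Fin n := ⟨0, hn0⟩ with hj0
    obtain ⟨y₁, hy₁, hmem⟩ := ha (Matrix.single μ j0 (1 : k))
    simp only [mulBilin_apply] at hmem
    have h1 := hW00 _ hmem i0 j0 rfl rfl
    have h2 : (a * y₁) i0 j0 = 0 := (mul_mem_colZero a hy₁) i0 j0 (by simp [hj0])
    rw [Matrix.sub_apply, h2, sub_zero, mul_single_apply', if_pos rfl] at h1
    exact hμ h1

/-- **Bläser 2003, Lemma 5 with Lemma 3**: under the hypotheses of Lemma 5, a bilinear
computation of `⟨c, m, n⟩` in which the `w_i`, `i ∈ N`, lie in `W_1 + ⋯ + W_t` has length at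
least `cm + m(n − 1) + |N|`. [cite: Blaser2003, Lemma 5] -/
theorem blaser2003_lemma5_card (β : BilinComp (mulBilin k c m n) ι) (hc : 0 < c) {t : ℕ}
    (ht1 : 1 ≤ t) (htn : t ≤ n) (Wf : ℕ → Submodule k (Matrix (Fin c) (Fin n) k))
    (hZ : ∀ τ, 1 ≤ τ → τ < t → Wf τ ≤ zSub k c n τ)
    (hdisj : ∀ τ, 1 ≤ τ → τ < t → Disjoint (Wf τ) (colZero k c n τ))
    (hLt : Wf t ≤ colZero k c n t) (hdim : finrank k (Wf t) < c) (N : Finset ι)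
    (hN : ∀ i ∈ N, β.w i ∈ ⨆ τ ∈ Finset.Icc 1 t, Wf τ) :
    c * m + m * (n - 1) + N.card ≤ Fintype.card ι := by
  classical
  have hsep := blaser2003_lemma5 β hc ht1 htn Wf hZ hdisj hLt hdim
  have h := hsep.finrank_add_finrank_add_card_le N hN
  have htop : finrank k (⊤ : Submodule k (Matrix (Fin c) (Fin m) k)) = c * m := by
    rw [finrank_top, Module.finrank_matrix]; simp
  have hL1 : m * (n - 1) ≤ finrank k (colZero k m n 1) := by
    -- the `m(n-1)` matrices `E_{μ j}`, `j ≥ 1`, are independent elements of `L_1`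
    let ν : Fin (n - 1) → Fin n := fun j => ⟨j + 1, by omega⟩
    have hν : Function.Injective ν := fun j j' h => Fin.ext (by simpa [ν] using congrArg Fin.val h)
    have hmem : ∀ p : Fin m × Fin (n - 1), Matrix.single p.1 (ν p.2) (1 : k) ∈ colZero k m n 1 := by
      intro p i j hj
      have : ν p.2 ≠ j := fun h => by simp [← h, ν] at hj
      exact Matrix.single_apply_of_col_ne _ _ this _
    have hli : LinearIndependent k fun p : Fin m × Fin (n - 1) =>
        Matrix.single p.1 (ν p.2) (1 : k) := by
      have h0 := (Matrix.stdBasis k (Fin m) (Fin n)).linearIndependent.comp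
        (fun p : Fin m × Fin (n - 1) => (p.1, ν p.2))
        (fun p q hpq => by
          simp only [Prod.mk.injEq] at hpq
          exact Prod.ext hpq.1 (hν hpq.2))
      have hfun : (fun p : Fin m × Fin (n - 1) => Matrix.single p.1 (ν p.2) (1 : k)) =
          ⇑(Matrix.stdBasis k (Fin m) (Fin n)) ∘ fun p : Fin m × Fin (n - 1) => (p.1, ν p.2) := by
        funext p
        rw [Function.comp_apply, Matrix.stdBasis_eq_single]
      rw [hfun]
      exact h0
    have hli' : LinearIndependent k fun p : Fin m × Fin (n - 1) =>
        (⟨Matrix.single p.1 (ν p.2) (1 : k), hmem p⟩ : colZero k m n 1) :=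
      LinearIndependent.of_comp (colZero k m n 1).subtype hli
    have := hli'.fintype_card_le_finrank
    simpa [Fintype.card_prod, Fintype.card_fin] using this
  rw [htop] at h
  omega

end Lemma5

end Literature.Computability.AlgebraicComplexity
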